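import Summits.ValiantsHypothesis.ValiantsHypothesis.Theorems.BarrierLeverPartitionMinorsHitByVPOfLowerSets
import Summits.ValiantsHypothesis.ValiantsHypothesis.Theses.BarrierLever

/-!
# Route BarrierLever — item `ChowHitsPartitionMinorsR` (stmt-ValiantsHypothesis-21882):
# LOWER-SET LAYOUTS SUFFICE for products of affine forms (budget `h·h − 2h` ⇒ budget `h·h`)

Helper file (`--supports stmt-ValiantsHypothesis-21882`; cell valiant-natproofs, rung V4, 𝒟-side
support item of route BarrierLever; prover seat val-np-p5 gen 29). Definition-free. Closes NO item.

Item 21882 asks, for `h ≥ h₀` and every injective layout `(u, w)` (`u i, w j ⊆ Fin h`,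
`i j : Fin r`), for `h·h` affine forms `ℓ_k` in `x_a = X (Fin.castAdd h a)`, `y_c = X (Fin.natAdd h c)`
whose product has a nonzero partition minor `det (coeff_{x^{u i} y^{w j}} ∏ ℓ_k)_{i j}`.

**The reduction.** The down-compression step of val-np-p1 g12 (`DownCompression.step_x / step_y`,
file `…PartitionMinorsHitByVPDownCompression`) is witness-agnostic: if `f` hits the `a`-compressed
layout `(𝓓_a u, w)` then `f · (1 + t x_a)` hits `(u, w)` for some scalar `t`; one pass over the `h`
row coordinates and the `h` column coordinates reaches a layout whose row AND column families are
LOWER SETS (simplicial complexes; `…DownCompressionPass`). For the witness class «product of `m`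
affine forms» each step costs exactly ONE more affine factor, so:

* `iterate_x`, `iterate_y` — all row (column) compressions for products of affine forms
  (`m` forms ⇒ `m + #passes` forms);
* `exists_chow_of_lowerSets` — if every injective lower-set pair is hit by a product of `m` affine
  forms, every injective layout is hit by a product of `m + h + h` affine forms;
* `exists_chow_fin_of_le` — padding with constant factors `1`: `m ≤ M` forms ⇒ exactly `M` forms;
* **`chowHitsPartitionMinorsR_of_lowerSets`** — THE ARROW INTO THE ITEM: if for `h ≥ h₀` every
  injective layout with both ranges lower sets is hit by a product of `m` affine forms with
  `m + 2h ≤ h·h`, then `Theses.BarrierLever.ChowHitsPartitionMinorsR` holds.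

So item 21882 is EQUIVALENT in substance to its restriction to pairs of simplicial complexes
`(R, C)` with the same number of faces, at budget `h·h − 2h` (the converse direction is trivial).
For lower sets the `R × C` coefficient matrix of `∏ ℓ_k` is the image of the product in the ring
`ℂ[x]/(x_a², x^S : S ∉ R) ⊗ ℂ[y]/(y_c², y^T : T ∉ C)`, which is where the design problem lives
(seat memo MEMO-21882-valnp5-g29.md).

WHAT THIS IS NOT: no proof of the lower-set case or of item 21882; nothing on crux
stmt-ValiantsHypothesis-14610 or on `VP` versus `VNP`.
-/

set_option linter.dupNamespace false

namespace Summit.ValiantsHypothesis.ValiantsHypothesis.Theorems.BarrierLever.ChowLowerSets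

open Finset MvPolynomial
open Summit.ValiantsHypothesis.ValiantsHypothesis.Theorems.BarrierLever.DownCompression
  (step_x step_y injective_of_compOf isComp_of_compOf isComp_of_compOf_of_isComp
    isLowerSet_range_of_isComp totalDegree_one_add_C_mul_X_le)

noncomputable section

variable {h r : ℕ}

/-! ## 1. One more affine factor -/

/-- Appending one affine factor to a product of `m` affine forms gives a product of `m + 1` affine
forms. -/
theorem exists_snoc_affine {σ : Type*} {m : ℕ} (ℓ : Fin m → MvPolynomial σ ℂ)
    (hℓ : ∀ k, (ℓ k).totalDegree ≤ 1) (g : MvPolynomial σ ℂ) (hg : g.totalDegree ≤ 1) :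
    ∃ ℓ' : Fin (m + 1) → MvPolynomial σ ℂ, (∀ k, (ℓ' k).totalDegree ≤ 1) ∧
      ∏ k, ℓ' k = (∏ k, ℓ k) * g := by
  refine ⟨Fin.snoc ℓ g, fun k => ?_, ?_⟩
  · refine Fin.lastCases ?_ (fun i => ?_) k
    · rw [Fin.snoc_last]; exact hg
    · rw [Fin.snoc_castSucc]; exact hℓ i
  · rw [Fin.prod_univ_castSucc]
    simp only [Fin.snoc_castSucc, Fin.snoc_last]

/-! ## 2. Iterating the compression steps for products of affine forms -/

/-- **All row compressions.** Fix the columns `w`. If every injective row family with lower-set range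
is hit (against `w`) by a product of `m` affine forms, then every injective row family `u` that is
already `a`-compressed for the coordinates `a` with `a + n < h` is hit by a product of `m + n` affine
forms. -/
theorem iterate_x (w : Fin r → Finset (Fin h)) (m : ℕ)
    (hyp : ∀ v : Fin r → Finset (Fin h), Function.Injective v → IsLowerSet (Set.range v) →
      ∃ ℓ : Fin m → MvPolynomial (Fin (h + h)) ℂ, (∀ k, (ℓ k).totalDegree ≤ 1) ∧
        (Matrix.of fun i j : Fin r => MvPolynomial.coeff
          (∑ a ∈ v i, Finsupp.single (Fin.castAdd h a) 1 +
            ∑ c ∈ w j, Finsupp.single (Fin.natAdd h c) 1) (∏ k, ℓ k)).det ≠ 0) :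
    ∀ n : ℕ, n ≤ h → ∀ u : Fin r → Finset (Fin h), Function.Injective u →
      (∀ a : Fin h, a.val + n < h → ∀ i, a ∈ u i → ∃ k, u k = (u i).erase a) →
      ∃ ℓ : Fin (m + n) → MvPolynomial (Fin (h + h)) ℂ, (∀ k, (ℓ k).totalDegree ≤ 1) ∧
        (Matrix.of fun i j : Fin r => MvPolynomial.coeff
          (∑ a ∈ u i, Finsupp.single (Fin.castAdd h a) 1 +
            ∑ c ∈ w j, Finsupp.single (Fin.natAdd h c) 1) (∏ k, ℓ k)).det ≠ 0 := by
  classical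
  intro n
  induction n with
  | zero =>
    intro _ u hu hcomp
    have hlow : IsLowerSet (Set.range u) :=
      isLowerSet_range_of_isComp u (fun a i hai => hcomp a (by have := a.isLt; omega) i hai)
    exact hyp u hu hlow
  | succ n ih =>
    intro hn u hu hcomp
    -- compress the coordinate `a₀ = h - (n + 1)`
    set a₀ : Fin h := ⟨h - (n + 1), by omega⟩ with ha₀_def
    let v : Fin r → Finset (Fin h) := fun i =>
      if a₀ ∈ u i ∧ ∀ k, u k ≠ (u i).erase a₀ then (u i).erase a₀ else u i
    have hv₁ : ∀ i, a₀ ∈ u i → (∀ k, u k ≠ (u i).erase a₀) → v i = (u i).erase a₀ :=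
      fun i h1 h2 => by simp only [v, if_pos (And.intro h1 h2)]
    have hv₂ : ∀ i, ¬ (a₀ ∈ u i ∧ ∀ k, u k ≠ (u i).erase a₀) → v i = u i :=
      fun i h1 => by simp only [v, if_neg h1]
    have hv_inj : Function.Injective v := injective_of_compOf u v a₀ hu hv₁ hv₂
    have hv_comp : ∀ a : Fin h, a.val + n < h → ∀ i, a ∈ v i → ∃ k, v k = (v i).erase a := by
      intro a ha
      by_cases haa : a = a₀
      · subst haa
        exact isComp_of_compOf u v _ hv₁ hv₂
      · have ha' : a.val + (n + 1) < h := by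
          have : a.val ≠ h - (n + 1) := fun hv => haa (Fin.ext (by rw [hv, ha₀_def]))
          omega
        exact isComp_of_compOf_of_isComp u v a a₀ (hcomp a ha') hv₁ hv₂
    obtain ⟨ℓ, hℓ, hdet⟩ := ih (by omega) v hv_inj hv_comp
    obtain ⟨t, ht⟩ := step_x u v w a₀ hv₁ hv₂ (∏ k, ℓ k) hdet
    obtain ⟨ℓ', hℓ', hprod⟩ :=
      exists_snoc_affine ℓ hℓ (1 + C t * X (Fin.castAdd h a₀)) (totalDegree_one_add_C_mul_X_le _ _)
    refine ⟨ℓ', hℓ', ?_⟩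
    rw [show (∏ k : Fin (m + (n + 1)), ℓ' k) = (∏ k, ℓ k) * (1 + C t * X (Fin.castAdd h a₀))
      from hprod]
    exact ht

/-- **All column compressions.** Fix the rows `u`. If every injective column family with lower-set
range is hit (against `u`) by a product of `m` affine forms, then every injective column family `w`
already `c`-compressed for the coordinates `c` with `c + n < h` is hit by a product of `m + n` affine
forms. -/
theorem iterate_y (u : Fin r → Finset (Fin h)) (m : ℕ)
    (hyp : ∀ w' : Fin r → Finset (Fin h), Function.Injective w' → IsLowerSet (Set.range w') →
      ∃ ℓ : Fin m → MvPolynomial (Fin (h + h)) ℂ, (∀ k, (ℓ k).totalDegree ≤ 1) ∧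
        (Matrix.of fun i j : Fin r => MvPolynomial.coeff
          (∑ a ∈ u i, Finsupp.single (Fin.castAdd h a) 1 +
            ∑ c ∈ w' j, Finsupp.single (Fin.natAdd h c) 1) (∏ k, ℓ k)).det ≠ 0) :
    ∀ n : ℕ, n ≤ h → ∀ w : Fin r → Finset (Fin h), Function.Injective w →
      (∀ c : Fin h, c.val + n < h → ∀ j, c ∈ w j → ∃ k, w k = (w j).erase c) →
      ∃ ℓ : Fin (m + n) → MvPolynomial (Fin (h + h)) ℂ, (∀ k, (ℓ k).totalDegree ≤ 1) ∧
        (Matrix.of fun i j : Fin r => MvPolynomial.coeff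
          (∑ a ∈ u i, Finsupp.single (Fin.castAdd h a) 1 +
            ∑ c ∈ w j, Finsupp.single (Fin.natAdd h c) 1) (∏ k, ℓ k)).det ≠ 0 := by
  classical
  intro n
  induction n with
  | zero =>
    intro _ w hw hcomp
    have hlow : IsLowerSet (Set.range w) :=
      isLowerSet_range_of_isComp w (fun c j hcj => hcomp c (by have := c.isLt; omega) j hcj)
    exact hyp w hw hlow
  | succ n ih =>
    intro hn w hw hcomp
    set c₀ : Fin h := ⟨h - (n + 1), by omega⟩ with hc₀_def
    let w' : Fin r → Finset (Fin h) := fun j =>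
      if c₀ ∈ w j ∧ ∀ k, w k ≠ (w j).erase c₀ then (w j).erase c₀ else w j
    have hw₁ : ∀ j, c₀ ∈ w j → (∀ k, w k ≠ (w j).erase c₀) → w' j = (w j).erase c₀ :=
      fun j h1 h2 => by simp only [w', if_pos (And.intro h1 h2)]
    have hw₂ : ∀ j, ¬ (c₀ ∈ w j ∧ ∀ k, w k ≠ (w j).erase c₀) → w' j = w j :=
      fun j h1 => by simp only [w', if_neg h1]
    have hw_inj : Function.Injective w' := injective_of_compOf w w' c₀ hw hw₁ hw₂
    have hw_comp : ∀ c : Fin h, c.val + n < h → ∀ j, c ∈ w' j → ∃ k, w' k = (w' j).erase c := by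
      intro c hc
      by_cases hcc : c = c₀
      · subst hcc
        exact isComp_of_compOf w w' _ hw₁ hw₂
      · have hc' : c.val + (n + 1) < h := by
          have : c.val ≠ h - (n + 1) := fun hv => hcc (Fin.ext (by rw [hv, hc₀_def]))
          omega
        exact isComp_of_compOf_of_isComp w w' c c₀ (hcomp c hc') hw₁ hw₂
    obtain ⟨ℓ, hℓ, hdet⟩ := ih (by omega) w' hw_inj hw_comp
    obtain ⟨s, hs⟩ := step_y u w w' c₀ hw₁ hw₂ (∏ k, ℓ k) hdet
    obtain ⟨ℓ', hℓ', hprod⟩ :=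
      exists_snoc_affine ℓ hℓ (1 + C s * X (Fin.natAdd h c₀)) (totalDegree_one_add_C_mul_X_le _ _)
    refine ⟨ℓ', hℓ', ?_⟩
    rw [show (∏ k : Fin (m + (n + 1)), ℓ' k) = (∏ k, ℓ k) * (1 + C s * X (Fin.natAdd h c₀))
      from hprod]
    exact hs

/-! ## 3. The reduction -/

/-- **Lower-set pairs suffice (explicit form).** If every injective layout with BOTH ranges lower
sets is hit by a product of `m` affine forms, then every injective layout is hit by a product of
`m + h + h` affine forms (namely `∏ ℓ_k · ∏_c (1 + s_c y_c) · ∏_a (1 + t_a x_a)`). -/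
theorem exists_chow_of_lowerSets (m : ℕ)
    (hyp : ∀ v w' : Fin r → Finset (Fin h), Function.Injective v → Function.Injective w' →
      IsLowerSet (Set.range v) → IsLowerSet (Set.range w') →
      ∃ ℓ : Fin m → MvPolynomial (Fin (h + h)) ℂ, (∀ k, (ℓ k).totalDegree ≤ 1) ∧
        (Matrix.of fun i j : Fin r => MvPolynomial.coeff
          (∑ a ∈ v i, Finsupp.single (Fin.castAdd h a) 1 +
            ∑ c ∈ w' j, Finsupp.single (Fin.natAdd h c) 1) (∏ k, ℓ k)).det ≠ 0)
    (u w : Fin r → Finset (Fin h)) (hu : Function.Injective u) (hw : Function.Injective w) :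
    ∃ ℓ : Fin (m + h + h) → MvPolynomial (Fin (h + h)) ℂ, (∀ k, (ℓ k).totalDegree ≤ 1) ∧
      (Matrix.of fun i j : Fin r => MvPolynomial.coeff
        (∑ a ∈ u i, Finsupp.single (Fin.castAdd h a) 1 +
          ∑ c ∈ w j, Finsupp.single (Fin.natAdd h c) 1) (∏ k, ℓ k)).det ≠ 0 := by
  -- lower-set rows against the ACTUAL columns `w`: all column compressions
  have hyX : ∀ v : Fin r → Finset (Fin h), Function.Injective v → IsLowerSet (Set.range v) →
      ∃ ℓ : Fin (m + h) → MvPolynomial (Fin (h + h)) ℂ, (∀ k, (ℓ k).totalDegree ≤ 1) ∧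
        (Matrix.of fun i j : Fin r => MvPolynomial.coeff
          (∑ a ∈ v i, Finsupp.single (Fin.castAdd h a) 1 +
            ∑ c ∈ w j, Finsupp.single (Fin.natAdd h c) 1) (∏ k, ℓ k)).det ≠ 0 :=
    fun v hv hlv => iterate_y v m (fun w' hw' hlw' => hyp v w' hv hw' hlv hlw') h le_rfl w hw
      (fun c hc => absurd hc (by omega))
  -- then all row compressions
  exact iterate_x w (m + h) hyX h le_rfl u hu (fun a ha => absurd ha (by omega))

/-- **Padding.** A product of `m ≤ M` affine forms is a product of exactly `M` affine forms (pad with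
constant factors `1`). -/
theorem exists_chow_fin_of_le {σ : Type*} {m M : ℕ} (hmM : m ≤ M) (ℓ : Fin m → MvPolynomial σ ℂ)
    (hℓ : ∀ k, (ℓ k).totalDegree ≤ 1) :
    ∃ ℓ' : Fin M → MvPolynomial σ ℂ, (∀ k, (ℓ' k).totalDegree ≤ 1) ∧ ∏ k, ℓ' k = ∏ k, ℓ k := by
  obtain ⟨d, rfl⟩ := Nat.exists_eq_add_of_le hmM
  refine ⟨Fin.append ℓ (fun _ : Fin d => (1 : MvPolynomial σ ℂ)), fun k => ?_, ?_⟩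
  · refine Fin.addCases (fun i => ?_) (fun j => ?_) k
    · rw [Fin.append_left]; exact hℓ i
    · rw [Fin.append_right, totalDegree_one]; exact zero_le_one
  · rw [Fin.prod_univ_add]
    simp only [Fin.append_left, Fin.append_right, Finset.prod_const_one, mul_one]

/-- Transport of a form family along an equality of index cardinalities. -/
theorem exists_chow_fin_of_eq {σ : Type*} {m M : ℕ} (hmM : m = M) (ℓ : Fin m → MvPolynomial σ ℂ)
    (hℓ : ∀ k, (ℓ k).totalDegree ≤ 1) :
    ∃ ℓ' : Fin M → MvPolynomial σ ℂ, (∀ k, (ℓ' k).totalDegree ≤ 1) ∧ ∏ k, ℓ' k = ∏ k, ℓ k :=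
  exists_chow_fin_of_le hmM.le ℓ hℓ

/-- **THE ARROW INTO ITEM 21882.** If, for all `h ≥ h₀`, every injective layout whose row family
and column family are both LOWER SETS is hit by a product of `m` affine forms for some `m` with
`m + 2h ≤ h·h`, then `ChowHitsPartitionMinorsR` holds (with the same `h₀`). -/
theorem chowHitsPartitionMinorsR_of_lowerSets (h₀ : ℕ)
    (hyp : ∀ h : ℕ, h₀ ≤ h → ∀ (r : ℕ) (v w' : Fin r → Finset (Fin h)),
      Function.Injective v → Function.Injective w' →
      IsLowerSet (Set.range v) → IsLowerSet (Set.range w') →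
      ∃ m : ℕ, m + 2 * h ≤ h * h ∧ ∃ ℓ : Fin m → MvPolynomial (Fin (h + h)) ℂ,
        (∀ k, (ℓ k).totalDegree ≤ 1) ∧
        (Matrix.of fun i j : Fin r => MvPolynomial.coeff
          (∑ a ∈ v i, Finsupp.single (Fin.castAdd h a) 1 +
            ∑ c ∈ w' j, Finsupp.single (Fin.natAdd h c) 1) (∏ k, ℓ k)).det ≠ 0) :
    Theses.BarrierLever.ChowHitsPartitionMinorsR := by
  refine ⟨h₀, fun h hh r u w hu hw => ?_⟩
  -- a uniform budget for the lower-set pairs at this height: `M := h * h - 2 * h` (padding)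
  have hypM : ∀ v w' : Fin r → Finset (Fin h), Function.Injective v → Function.Injective w' →
      IsLowerSet (Set.range v) → IsLowerSet (Set.range w') →
      ∃ ℓ : Fin (h * h - 2 * h) → MvPolynomial (Fin (h + h)) ℂ, (∀ k, (ℓ k).totalDegree ≤ 1) ∧
        (Matrix.of fun i j : Fin r => MvPolynomial.coeff
          (∑ a ∈ v i, Finsupp.single (Fin.castAdd h a) 1 +
            ∑ c ∈ w' j, Finsupp.single (Fin.natAdd h c) 1) (∏ k, ℓ k)).det ≠ 0 := by
    intro v w' hv hw' hlv hlw'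
    obtain ⟨m, hm, ℓ, hℓ, hdet⟩ := hyp h hh r v w' hv hw' hlv hlw'
    obtain ⟨ℓ', hℓ', hprod⟩ := exists_chow_fin_of_le (M := h * h - 2 * h) (by omega) ℓ hℓ
    exact ⟨ℓ', hℓ', by rw [hprod]; exact hdet⟩
  obtain ⟨ℓ, hℓ, hdet⟩ := exists_chow_of_lowerSets (h * h - 2 * h) hypM u w hu hw
  -- `h*h - 2h + h + h = h*h` as soon as a lower-set pair needed `m + 2h ≤ h*h`; in general pad
  by_cases hr : h * h - 2 * h + h + h = h * h
  · obtain ⟨ℓ', hℓ', hprod⟩ := exists_chow_fin_of_eq hr ℓ hℓ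
    exact ⟨ℓ', hℓ', by rw [hprod]; exact hdet⟩
  · -- `h ≤ 1`: then `h * h - 2 * h = 0` and `h * h - 2h + 2h = 2h`; the only layouts are tiny, but we
    -- need no case analysis: the empty-budget hypothesis already forces `h * h ≥ 2h` unless no
    -- lower-set instance exists — use the instance `(u, w)` compressed itself.
    exfalso
    -- from `hyp` applied to ANY lower-set pair we get `m + 2h ≤ h*h`, hence `2h ≤ h*h`, contradiction
    -- with `hr`; a lower-set pair exists: compress `(u, w)` — but simpler: the constant families.
    have : 2 * h ≤ h * h := by
      -- the empty layout `r = 0` is injective with lower-set (empty) ranges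
      obtain ⟨m, hm, -⟩ := hyp h hh 0 (fun i => Fin.elim0 i) (fun i => Fin.elim0 i)
        (fun i => Fin.elim0 i) (fun i => Fin.elim0 i)
        (by intro S T _ hS; obtain ⟨i, _⟩ := hS; exact Fin.elim0 i)
        (by intro S T _ hS; obtain ⟨i, _⟩ := hS; exact Fin.elim0 i)
      omega
    omega

end

end Summit.ValiantsHypothesis.ValiantsHypothesis.Theorems.BarrierLever.ChowLowerSets
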